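import Mathlib.Analysis.Complex.Basic
import Mathlib.Topology.Order.IntermediateValue
import Mathlib.Topology.Algebra.Order.Field
import Mathlib.Analysis.SpecialFunctions.Pow.Real

/-!
# Helper `helper_handlebodyChart_modelHandles` (M3: handle structure of the model dotted handlebody `D_k`)
# of line `mk_friends` for crux `DcrGap` — the cut-off radial flow, part 3: the end state
(item stmt-SmoothPoincare4-16128, route route-SmoothPoincare4-DottedCircleRasmussen)

**Registered piece `helper_handlebodyChart_modelHandles_radialEnd` of the model lemma M3.**  The last stage
of the squeeze of part 2 of the data stub `helper_handlebodyChart_modelHandles_data` is the time-`T` map of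
the cut-off radial flow towards the base centre `z₀` (`…ModelHandlesRadialFlow`): the shadow of an orbit moves
along its ray, `z(t) = z₀ + s(t) u` (`|u| = 1`, `s` continuous, positive, non-increasing), never enters a
stall disc `|z - c_j| ≤ 8/5`, starts with all `|z - c_j|² ≥ 11/4`, and runs at full speed (`s' = -s`) while
outside all the stall layers `|z - c_j| < 41/25`.  Writing `c_j - z₀ = w_j u`, the squared distance to the
`j`-th hole is the parabola `(s - Re w_j)² + (Im w_j)²` in `s`, and this file carries out the elementary
**end-state analysis** (`ModelHandles.radial_end`): at time `T` either the shadow is within `2/15` of `z₀`,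
or it lies in a stall layer on the far/lateral side of its hole (`Re((q - v) \bar v) ≥ -(7/10)|v|`: an orbit
heading into the disc stops before the foot of the perpendicular, an orbit grazing the layer has lateral
offset `|Im w_j| ≥ 8/5`), or it has crossed a layer laterally and lies on the wedge of rays of lateral offset
`∈ [8/5, 41/25]` beyond the chord — the three alternatives "ball / cap / legs" of the explicit arches of the
split of the data stub.  Pure one-variable real analysis (monotonicity and the intermediate value theorem).

No definitions, no named facts, no `sorry`.  References: J. Milnor, *Morse Theory* (1963), §3 [Milnor1963].
-/

-- the prescribed namespace `Summit.<P>.<Sub>.…` duplicates `SmoothPoincare4` (P = Sub)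
set_option linter.dupNamespace false
set_option linter.style.longLine false

noncomputable section

open Set

namespace Summit.SmoothPoincare4.SmoothPoincare4.Theorems.DcrGap.MkFriends

namespace ModelHandles

/-- **End state of the cut-off radial flow** (see the module docstring): ball, cap or legs. [folklore] -/
theorem radial_end {k : ℕ} {s : ℝ → ℝ} {w : Fin k → ℂ} {N T : ℝ} (hT : 0 ≤ T)
    (hs0 : s 0 = N) (hsc : ContinuousOn s (Icc 0 T)) (hanti : AntitoneOn s (Icc 0 T))
    (hpos : ∀ t ∈ Icc 0 T, 0 < s t)
    (hinit : ∀ j, (11 : ℝ) / 4 ≤ (s 0 - (w j).re) ^ 2 + (w j).im ^ 2)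
    (hbar : ∀ t ∈ Icc 0 T, ∀ j, (64 : ℝ) / 25 < (s t - (w j).re) ^ 2 + (w j).im ^ 2)
    (hfull : (∀ t ∈ Icc 0 T, ∀ j, (1681 : ℝ) / 625 ≤ (s t - (w j).re) ^ 2 + (w j).im ^ 2) → s T ≤ 2 / 15)
    (hw : ∀ j, (20 : ℝ) ≤ ‖w j‖) :
    s T ≤ 2 / 15 ∨ ∃ j,
      ((64 : ℝ) / 25 ≤ (s T - (w j).re) ^ 2 + (w j).im ^ 2 ∧ (s T - (w j).re) ^ 2 + (w j).im ^ 2 ≤ 1681 / 625 ∧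
        -(7 / 10) * ‖w j‖ ≤ s T * (w j).re - ‖w j‖ ^ 2) ∨
      (2 / 15 ≤ s T ∧ s T ≤ ‖w j‖ + 1 / 2 ∧ 0 < s T * (w j).re ∧ 8 / 5 * s T ≤ |s T * (w j).im| ∧
        |s T * (w j).im| ≤ 41 / 25 * s T) := by
  have hT0 : (0 : ℝ) ∈ Icc 0 T := ⟨le_rfl, hT⟩
  have hTT : T ∈ Icc 0 T := ⟨hT, le_rfl⟩
  have hnorm : ∀ j, ‖w j‖ ^ 2 = (w j).re ^ 2 + (w j).im ^ 2 := fun j => by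
    rw [Complex.sq_norm, Complex.normSq_apply]; ring
  have hαle : ∀ j, |(w j).re| ≤ ‖w j‖ := fun j => Complex.abs_re_le_norm _
  -- Claim 1: a time in a stall layer forces `Re w ≤ N` (the orbit started before the foot)
  have claim1 : ∀ j, ∀ t₁ ∈ Icc 0 T, (s t₁ - (w j).re) ^ 2 + (w j).im ^ 2 ≤ 1681 / 625 → (w j).re ≤ N := by
    intro j t₁ ht₁ hD
    have hs1 : s t₁ ≤ N := by rw [← hs0]; exact hanti hT0 ht₁ ht₁.1
    by_contra hlt
    push Not at hlt
    have h2 : (w j).re - N ≤ (w j).re - s t₁ := by linarith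
    have h3 := pow_le_pow_left₀ (by linarith) h2 2
    have h4 := hinit j
    rw [hs0] at h4
    nlinarith [h3]
  -- Claim 2: a line through the stall disc is never crossed (the foot is not reached)
  have claim2 : ∀ j, (w j).re ≤ N → (w j).im ^ 2 < 64 / 25 → ∀ t ∈ Icc 0 T, 0 < s t - (w j).re := by
    intro j hle hm t ht
    have hne : ∀ t' ∈ Icc 0 T, s t' - (w j).re ≠ 0 := fun t' ht' h => by
      have := hbar t' ht' j; rw [h] at this; linarith
    have h0 : 0 < s 0 - (w j).re := lt_of_le_of_ne (by rw [hs0]; linarith) (hne 0 hT0).symm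
    by_contra hle'
    push Not at hle'
    have hc : ContinuousOn (fun t => s t - (w j).re) (Icc 0 t) :=
      (hsc.mono (Icc_subset_Icc le_rfl ht.2)).sub continuousOn_const
    obtain ⟨c, hc', hc0⟩ := intermediate_value_Icc' ht.1 hc ⟨hle', h0.le⟩
    exact hne c ⟨hc'.1, hc'.2.trans ht.2⟩ hc0
  -- `Re w > 0` whenever the shadow is within `41/25` of the hole
  have hαpos : ∀ j, ∀ t ∈ Icc 0 T, (s t - (w j).re) ^ 2 + (w j).im ^ 2 ≤ 1681 / 625 → 0 < (w j).re := by
    intro j t ht hD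
    by_contra hle
    push Not at hle
    have hs := hpos t ht
    have h1 : 0 ≤ s t * (s t - 2 * (w j).re) := mul_nonneg hs.le (by linarith)
    nlinarith [hnorm j, hw j, norm_nonneg (w j)]
  by_cases hA : ∃ j, (s T - (w j).re) ^ 2 + (w j).im ^ 2 ≤ 1681 / 625
  · -- (A) the shadow ends in a stall layer: the cap
    obtain ⟨j, hj⟩ := hA
    refine Or.inr ⟨j, Or.inl ⟨(hbar T hTT j).le, hj, ?_⟩⟩
    have hαN := claim1 j T hTT hj
    have hid : s T * (w j).re - ‖w j‖ ^ 2 = (w j).re * (s T - (w j).re) - (w j).im ^ 2 := by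
      rw [hnorm j]; ring
    rw [hid]
    by_cases hm : (64 : ℝ) / 25 ≤ (w j).im ^ 2
    · -- grazing: lateral offset `≥ 8/5`, so `|s - Re w| ≤ 9/25`
      have h1 : |s T - (w j).re| ≤ 9 / 25 := by
        have h : (s T - (w j).re) ^ 2 ≤ (9 / 25 : ℝ) ^ 2 := by nlinarith
        simpa [abs_of_pos (show (0:ℝ) < 9 / 25 by norm_num)] using sq_le_sq.1 h
      have h2 : |(w j).re * (s T - (w j).re)| ≤ ‖w j‖ * (9 / 25) := by
        rw [abs_mul]; exact mul_le_mul (hαle j) h1 (abs_nonneg _) (norm_nonneg _)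
      have h3 := neg_abs_le ((w j).re * (s T - (w j).re))
      nlinarith [hw j]
    · -- heading into the disc: the foot is not reached, `s - Re w > 0`
      push Not at hm
      have h1 := claim2 j hαN hm T hTT
      have h2 := hαpos j T hTT hj
      nlinarith [hw j, mul_pos h2 h1]
  · push Not at hA
    by_cases hB : ∀ t ∈ Icc 0 T, ∀ j, (1681 : ℝ) / 625 ≤ (s t - (w j).re) ^ 2 + (w j).im ^ 2
    · -- (B1) full speed all along: the ball
      exact Or.inl (hfull hB)
    · -- (B2) a stall layer was crossed laterally: the legs (or the ball)
      push Not at hB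
      obtain ⟨t₁, ht₁, j, hj⟩ := hB
      by_cases hsmall : s T ≤ 2 / 15
      · exact Or.inl hsmall
      push Not at hsmall
      refine Or.inr ⟨j, Or.inr ?_⟩
      have hαN := claim1 j t₁ ht₁ hj.le
      have hsT : s T ≤ s t₁ := hanti ht₁ hTT ht₁.2
      have hsTpos : 0 < s T := hpos T hTT
      -- past the layer: `s_T < Re w`
      have hlt : s T - (w j).re < 0 := by
        have hDT := hA j
        by_contra hge
        push Not at hge
        have : (s T - s t₁) * (s T + s t₁ - 2 * (w j).re) ≤ 0 :=
          mul_nonpos_of_nonpos_of_nonneg (by linarith) (by linarith)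
        nlinarith
      -- hence the line missed the disc: lateral offset `≥ 8/5`
      have hm : (64 : ℝ) / 25 ≤ (w j).im ^ 2 := by
        by_contra hm
        push Not at hm
        linarith [claim2 j hαN hm T hTT]
      have hαp := hαpos j t₁ ht₁ hj.le
      have habsβ : 8 / 5 ≤ |(w j).im| := by
        by_contra h; push Not at h
        nlinarith [abs_nonneg (w j).im, sq_abs (w j).im]
      have habsβ' : |(w j).im| ≤ 41 / 25 := by
        by_contra h; push Not at h
        nlinarith [abs_nonneg (w j).im, sq_abs (w j).im, sq_nonneg (s t₁ - (w j).re)]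
      have h1 : s t₁ - (w j).re < 9 / 25 := by
        by_contra h; push Not at h
        nlinarith
      refine ⟨hsmall.le, ?_, mul_pos hsTpos hαp, ?_, ?_⟩
      · linarith [le_abs_self (w j).re, hαle j]
      · rw [abs_mul, abs_of_pos hsTpos]; nlinarith
      · rw [abs_mul, abs_of_pos hsTpos]; nlinarith

end ModelHandles

/-- **Registered piece `helper_handlebodyChart_modelHandles_radialEnd` of the model lemma M3 (end state of
the cut-off radial flow: ball, cap or legs)**: `ModelHandles.radial_end`, fully quantified. [folklore] -/
theorem helper_handlebodyChart_modelHandles_radialEnd : ∀ (k : ℕ) (s : ℝ → ℝ) (w : Fin k → ℂ) (N T : ℝ), 0 ≤ T → s 0 = N → ContinuousOn s (Set.Icc 0 T) → AntitoneOn s (Set.Icc 0 T) → (∀ t ∈ Set.Icc 0 T, 0 < s t) → (∀ j, (11 : ℝ) / 4 ≤ (s 0 - (w j).re) ^ 2 + (w j).im ^ 2) → (∀ t ∈ Set.Icc 0 T, ∀ j, (64 : ℝ) / 25 < (s t - (w j).re) ^ 2 + (w j).im ^ 2) → ((∀ t ∈ Set.Icc 0 T, ∀ j, (1681 : ℝ)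 / 625 ≤ (s t - (w j).re) ^ 2 + (w j).im ^ 2) → s T ≤ 2 / 15) → (∀ j, (20 : ℝ) ≤ ‖w j‖) → s T ≤ 2 / 15 ∨ ∃ j, ((64 : ℝ) / 25 ≤ (s T - (w j).re) ^ 2 + (w j).im ^ 2 ∧ (s T - (w j).re) ^ 2 + (w j).im ^ 2 ≤ 1681 / 625 ∧ -(7 / 10) * ‖w j‖ ≤ s T * (w j).re - ‖w j‖ ^ 2) ∨ (2 / 15 ≤ s T ∧ s T ≤ ‖w j‖ + 1 / 2 ∧ 0 < s T * (w j).re ∧ 8 / 5 * s T ≤ |s T * (w j).im| ∧ |s T * (w j).im| ≤ 41 / 25 * s T) :=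
  fun _ _ _ _ _ hT hs0 hsc hanti hpos hinit hbar hfull hw =>
    ModelHandles.radial_end hT hs0 hsc hanti hpos hinit hbar hfull hw

end Summit.SmoothPoincare4.SmoothPoincare4.Theorems.DcrGap.MkFriends

end
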